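import Summits.CriticalPhenomena.PercolationContinuityZ3.Theorems.FK.Transplant.KNFreeSeedsEnergy
import HarnessLib

/-!
# FRONTIER TRANSPLANT, row FT-03(a), part 5: Step III of KN Lemma 10 for a GENERAL seed assignment, and the CUBE seeds
# (window ∪ inward layer ∪ contact edge ∪ all edges of the cube behind the plaquette) that the launch-consumption Prop needs

Support file (`--supports stmt-CriticalPhenomena-4575`, helper) of the FRONTIER TRANSPLANT sub-cell (`fk-continuity/transplant/`,
registry row FT-03 / BINDER-OWNERS row 3, seat `prim-bschramm-fkt-p1`); builds on p205010 (kernel theorem, internal audit signed;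
external expert review pending).  No definitions, no named facts, no sorries; standard axioms.

HONEST FRAMING (page 1, cell rule).  The transplant's theorem of record `ufsc0_of_freeBoundaryHypothesis_r0` is CONDITIONAL on the
free-boundary penetration hypothesis FH — open at the same `p` for every `q > 1`; by the referee's calibration K1, [C3a for all
`p > p_c(q)`] ∧ C3b gives `p̂_c(q) = p_c(q)`, Grimmett's Conjecture (5.103) / Duminil-Copin–Tassion's Question 5, open for `q ∈ (1,2)`;
barrier note `Literature.Barriers.CriticalPhenomena.SamePFreeBoundaryCriteria` (FBN-01).  The transplant is a typed reduction, not a proof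
of FK continuity.  THIS FILE is unconditional: Step III of KN Lemma 10 with the measure AND the seed shape as parameters.

WHY (seat design note `transplant/prim-bschramm-fkt-p1/FT03-DESIGN.md` §2.2).  The transplant consumes hittability only through
`FKLaunchAt` (FT-01), whose seed is a wired CUBE `GM.ball v m`; Kozma–Nitzan's seed (p. 19; tree `seedEdges`: window, inward layer,
contact edge) is a `(d-1)`-dimensional patch.  So Step III must manufacture, behind a contact vertex `x` of the explored cluster, the
KN seed TOGETHER WITH all lattice edges of the cube `Q_x = L.cubeX j M x` (tree; `= GM.ball (L.vX j M x) M`, whose outward face is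
the landing set `ufaceX` of the layer): then `x` is joined by open edges to every vertex of `Q_x`.  Part 1 (`KNFreeSeedsEnergy.lean`)
proved eq. (19) for the tree's seed; here the same sequential-insertion-tolerance argument is run for ANY assignment `x ↦ F x` of
finite sets of pairs satisfying the four properties the proof uses, and then instantiated with the cube seeds.

RESULTS (namespace `…Theorems.FK.KNFree`):
* **`real_manyContacts_diff_biUnion_le`** — Step III, eq. (19), for a general seed assignment `F` under insertion tolerance:
  if on the outer boundary of `B⟨j⟩` (i) the pairs of `F x` have weight `p`, (ii) `#(F x) ≤ s`, (iii) `F x` avoids the pairs of the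
  region outside `B⟨j⟩`, (iv) `F x`, `F x'` are disjoint when `x' - x ∉ Λ_{2·Rsep M}`, then
  `μ(≥ Ncont d M k contacts at level j, no selected contact x with F x open) ≤ (1 - π^s)^k`;
* cube-seed geometry: `sub_mem_box_of_mem_cubeX` (the cube lies within sup-distance `2M+4` of its contact vertex), `cubeX_subset_X`,
  `card_edgesIn_cubeX_le`, `cubeSeed_disjoint`, `W_cubeSeed` (weight `p`), `cubeSeed_not_mem_wireSet_region`;
* **`real_manyContacts_diff_cubeSeeds_le`** — eq. (19) for the cube seeds `L.seedE j M x ∪ edgesIn (zdGraph d) (L.cubeX j M x)` with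
  `s = seedBound d M + 2d(2M+1)^d`;
* `openConn_of_cubeSeed_subset` — an open cube seed joins its contact vertex to every vertex of the cube.
[cite: KozmaNitzan2024, §4 Lemma 10 Step III, eq. (19) (p. 19); p. 21 (U(P), v(P))] [cite: Grimmett2006, Thm. (3.1) eq. (3.4) (p. 38); Thm. (4.17)(b) (p. 75)]
-/

noncomputable section

namespace Summit.CriticalPhenomena.PercolationContinuityZ3.Theorems.FK.KNFree

open MeasureTheory Set SimpleGraph
open Literature.Probability.Percolation Literature.Probability.LatticeModels
open Literature.Probability.Percolation.KozmaNitzan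
open scoped Classical

variable {d : ℕ}

variable {W : Sym2 (Site d) → unitInterval} {p : unitInterval} (μ : Measure (BondConfig (Site d))) [IsProbabilityMeasure μ]

/-! ## Step III for a general seed assignment -/

section General

variable {L : LData d}

/-- **STEP III, eq. (19), under `μ`, for a general seed assignment `x ↦ F x`**: with at least `Ncont d M k` contact vertices at level
`j`, the probability that no selected contact vertex `x` has all pairs of `F x` open is at most `(1 - π^s)^k`, provided (i) the pairs of
`F x` carry weight `p`, (ii) `#(F x) ≤ s`, (iii) `F x` avoids the pairs of the region outside `B⟨j⟩`, (iv) far-apart contacts have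
disjoint seed sets.  Sequential insertion tolerance over the `k` selected (pairwise `2·Rsep M`-separated) contacts, exactly as in
`real_manyContacts_diff_Gev_le`. [cite: KozmaNitzan2024, §4 p. 19 eq. (19)] [cite: Grimmett2006, Thm. (4.17)(b) (p. 75)] -/
theorem real_manyContacts_diff_biUnion_le {π : ℝ} (hπ0 : 0 ≤ π) (hπ1 : π ≤ 1)
    (hins : ∀ (F : Finset (Sym2 (Site d))) (A : Set (BondConfig (Site d))), (∀ e ∈ F, W e = p) → MeasurableSet A →
      π ^ F.card * μ.real ((fun ω => ω ∪ ↑F) ⁻¹' A) ≤ μ.real A)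
    {j M k s : ℕ} (F : Site d → Finset (Sym2 (Site d)))
    (hFW : ∀ x ∈ outerBoundary (zdGraph d) (L.X j), ∀ e ∈ F x, W e = p)
    (hFcard : ∀ x ∈ outerBoundary (zdGraph d) (L.X j), (F x).card ≤ s)
    (hFreg : ∀ x ∈ outerBoundary (zdGraph d) (L.X j), ∀ e ∈ F x, e ∉ wireSet (L.region j))
    (hFdisj : ∀ x ∈ outerBoundary (zdGraph d) (L.X j), ∀ x' ∈ outerBoundary (zdGraph d) (L.X j), x ≠ x' →
      x' - x ∉ box d (2 * LData.Rsep M) → Disjoint (F x) (F x')) :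
    μ.real ((L.Fail (LData.Ncont d M k) j)ᶜ \
        ⋃ x ∈ outerBoundary (zdGraph d) (L.X j), ({ω | x ∈ L.sel j M k ω} ∩ {ω | (↑(F x) : Set (Sym2 (Site d))) ⊆ ω})) ≤
      (1 - π ^ s) ^ k := by
  set N := LData.Ncont d M k with hN
  set OB := outerBoundary (zdGraph d) (L.X j) with hOB
  set Bκ : Finset (Site d) → Set (BondConfig (Site d)) := fun κ => {ω | L.Kont j ω = κ} with hBκ
  set Cx : Site d → Set (BondConfig (Site d)) := fun x => {ω | ¬ (↑(F x) : Set (Sym2 (Site d))) ⊆ ω} with hCx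
  set q : ℝ := 1 - π ^ s with hq
  have hq0 : 0 ≤ q := by rw [hq, sub_nonneg]; exact pow_le_one₀ hπ0 hπ1
  -- covering
  have hcov : (L.Fail N j)ᶜ \ (⋃ x ∈ OB, ({ω | x ∈ L.sel j M k ω} ∩ {ω | (↑(F x) : Set (Sym2 (Site d))) ⊆ ω})) ⊆
      ⋃ κ ∈ OB.powerset.filter (fun κ => N ≤ κ.card), (Bκ κ ∩ ⋂ x ∈ LData.selOf M k κ, Cx x) := by
    rintro ω ⟨hE, hG⟩
    simp only [LData.Fail, Set.mem_compl_iff, Set.mem_setOf_eq, not_lt] at hE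
    simp only [Set.mem_iUnion, Set.mem_iInter, Set.mem_inter_iff, Finset.mem_filter, Finset.mem_powerset,
      exists_prop, hBκ, hCx, Set.mem_setOf_eq]
    refine ⟨L.Kont j ω, ⟨Finset.filter_subset _ _, hE⟩, rfl, fun x hx hseed => hG ?_⟩
    simp only [Set.mem_iUnion, Set.mem_inter_iff, Set.mem_setOf_eq, exists_prop]
    exact ⟨x, Finset.filter_subset _ _ (LData.selOf_subset _ hx), hx, hseed⟩
  -- locality of the pieces
  have hBdet : ∀ κ, DeterminedBy (Bκ κ) (wireSet (L.region j)) := by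
    intro κ; rw [determinedBy_iff]; intro ω ω' hω
    have h1 : ∀ e ∈ wireSet (L.region j), e ∈ ω ↔ e ∈ ω' := fun e he => by
      have := Set.ext_iff.1 hω e
      simp only [Set.mem_inter_iff] at this
      exact ⟨fun h' => (this.1 ⟨h', he⟩).1, fun h' => (this.2 ⟨h', he⟩).1⟩
    simp only [hBκ, Set.mem_setOf_eq, LData.Kont_congr h1]
  have hBm : ∀ κ, MeasurableSet (Bκ κ) := fun κ =>
    ((hBdet κ).mono (L.wireSet_region_subset j)).measurableSet_of_finset
  have hCdet : ∀ x, DeterminedBy (Cx x) (↑(F x) : Set (Sym2 (Site d))) := by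
    intro x; rw [determinedBy_iff]; intro ω ω' hω
    simp only [hCx, Set.mem_setOf_eq]
    rw [show ((↑(F x) : Set (Sym2 (Site d))) ⊆ ω ↔ (↑(F x) : Set (Sym2 (Site d))) ⊆ ω') from ?_]
    constructor
    · intro h e he; have := Set.ext_iff.1 hω e; simp only [Set.mem_inter_iff] at this
      exact (this.1 ⟨h he, he⟩).1
    · intro h e he; have := Set.ext_iff.1 hω e; simp only [Set.mem_inter_iff] at this
      exact (this.2 ⟨h he, he⟩).1
  have hCm : ∀ x, MeasurableSet (Cx x) := fun x => (hCdet x).measurableSet_of_finset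
  -- the piece estimate, by sequential insertion tolerance over the selected contacts
  have hpiece : ∀ κ ∈ OB.powerset.filter (fun κ => N ≤ κ.card),
      μ.real (Bκ κ ∩ ⋂ x ∈ LData.selOf M k κ, Cx x) ≤ q ^ k * μ.real (Bκ κ) := by
    intro κ hκ
    obtain ⟨hκOB, hκN⟩ := Finset.mem_filter.1 hκ
    rw [Finset.mem_powerset] at hκOB
    obtain ⟨hselκ, hcard, hsep⟩ := LData.selOf_spec (M := M) (k := k) hκN
    have hselOB : LData.selOf M k κ ⊆ OB := hselκ.trans hκOB
    have key : ∀ S : Finset (Site d), S ⊆ LData.selOf M k κ →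
        MeasurableSet (Bκ κ ∩ ⋂ x ∈ S, Cx x) ∧
          DeterminedBy (Bκ κ ∩ ⋂ x ∈ S, Cx x) (wireSet (L.region j) ∪ ⋃ x ∈ S, (↑(F x) : Set (Sym2 (Site d)))) ∧
          μ.real (Bκ κ ∩ ⋂ x ∈ S, Cx x) ≤ q ^ S.card * μ.real (Bκ κ) := by
      intro S
      induction S using Finset.induction_on with
      | empty =>
        intro _
        simp only [Finset.notMem_empty, Set.iInter_of_empty, Set.iInter_univ, Set.inter_univ, Set.iUnion_of_empty,
          Set.iUnion_empty, Set.union_empty, Finset.card_empty, pow_zero, one_mul]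
        exact ⟨hBm κ, hBdet κ, le_rfl⟩
      | insert a S haS ih =>
        intro hsub
        have haSel : a ∈ LData.selOf M k κ := hsub (Finset.mem_insert_self a S)
        have hSsub : S ⊆ LData.selOf M k κ := fun x hx => hsub (Finset.mem_insert_of_mem hx)
        obtain ⟨hEm, hEdet, hEle⟩ := ih hSsub
        have hEq : Bκ κ ∩ (⋂ x ∈ insert a S, Cx x) = (Bκ κ ∩ ⋂ x ∈ S, Cx x) ∩ Cx a := by
          rw [Finset.set_biInter_insert, Set.inter_left_comm, Set.inter_comm]
        have hKF : ∀ e ∈ F a, e ∉ wireSet (L.region j) ∪ ⋃ x ∈ S, (↑(F x) : Set (Sym2 (Site d))) := by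
          intro e he hmem
          rcases hmem with h1 | h2
          · exact hFreg a (hselOB haSel) e he h1
          · simp only [Set.mem_iUnion, exists_prop, Finset.mem_coe] at h2
            obtain ⟨x, hxS, hex⟩ := h2
            have hne : x ≠ a := fun h => haS (h ▸ hxS)
            have hfar : a - x ∉ box d (2 * LData.Rsep M) := hsep x (hSsub hxS) a haSel hne
            exact Finset.disjoint_left.1 (hFdisj x (hselOB (hSsub hxS)) a (hselOB haSel) hne hfar) hex he
        refine ⟨?_, ?_, ?_⟩
        · rw [hEq]; exact hEm.inter (hCm a)
        · rw [hEq, Finset.set_biUnion_insert]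
          refine DeterminedBy.inter (hEdet.mono ?_) ((hCdet a).mono ?_)
          · exact Set.union_subset_union_right _ Set.subset_union_right
          · exact Set.subset_union_of_subset_right Set.subset_union_left _
        · rw [hEq, Finset.card_insert_of_notMem haS, pow_succ]
          have h1 := real_inter_not_subset_le_of_ins μ hπ0 hins hEdet hKF hEm (hFW a (hselOB haSel))
          have hpow : π ^ s ≤ π ^ (F a).card := pow_le_pow_of_le_one hπ0 hπ1 (hFcard a (hselOB haSel))
          have hfac : 1 - π ^ (F a).card ≤ q := by rw [hq]; linarith
          calc μ.real ((Bκ κ ∩ ⋂ x ∈ S, Cx x) ∩ {ω | ¬ (↑(F a) : Set (Sym2 (Site d))) ⊆ ω})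
              ≤ (1 - π ^ (F a).card) * μ.real (Bκ κ ∩ ⋂ x ∈ S, Cx x) := h1
            _ ≤ q * μ.real (Bκ κ ∩ ⋂ x ∈ S, Cx x) := mul_le_mul_of_nonneg_right hfac measureReal_nonneg
            _ ≤ q * (q ^ S.card * μ.real (Bκ κ)) := mul_le_mul_of_nonneg_left hEle hq0
            _ = q ^ S.card * q * μ.real (Bκ κ) := by ring
    have := (key (LData.selOf M k κ) Finset.Subset.rfl).2.2
    rwa [hcard] at this
  -- sum up
  have hdisjB : (↑(OB.powerset.filter (fun κ => N ≤ κ.card)) : Set (Finset (Site d))).PairwiseDisjoint Bκ := by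
    intro κ _ κ' _ hne
    rw [Function.onFun, Set.disjoint_left]
    intro ω h1 h2
    exact hne (h1.symm.trans h2)
  calc μ.real ((L.Fail N j)ᶜ \ ⋃ x ∈ OB, ({ω | x ∈ L.sel j M k ω} ∩ {ω | (↑(F x) : Set (Sym2 (Site d))) ⊆ ω}))
      ≤ μ.real (⋃ κ ∈ OB.powerset.filter (fun κ => N ≤ κ.card), (Bκ κ ∩ ⋂ x ∈ LData.selOf M k κ, Cx x)) :=
        measureReal_mono hcov (measure_ne_top _ _)
    _ ≤ ∑ κ ∈ OB.powerset.filter (fun κ => N ≤ κ.card), μ.real (Bκ κ ∩ ⋂ x ∈ LData.selOf M k κ, Cx x) :=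
        measureReal_biUnion_finset_le _ _
    _ ≤ ∑ κ ∈ OB.powerset.filter (fun κ => N ≤ κ.card), q ^ k * μ.real (Bκ κ) := Finset.sum_le_sum hpiece
    _ = q ^ k * μ.real (⋃ κ ∈ OB.powerset.filter (fun κ => N ≤ κ.card), Bκ κ) := by
        rw [← Finset.mul_sum, measureReal_biUnion_finset hdisjB (fun κ _ => hBm κ)]
    _ ≤ q ^ k * 1 := mul_le_mul_of_nonneg_left measureReal_le_one (pow_nonneg hq0 k)
    _ = q ^ k := mul_one _

end General

/-! ## The cube seeds: geometry -/

section CubeGeometry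

variable {L : LData d}

/-- **The cube behind a contact vertex is local**: every vertex of `L.cubeX j M x` lies within sup-distance `2M + 4` of the contact
vertex `x` (in fact `2M + 2`). [cite: KozmaNitzan2024, §4 p. 21 (v(P) = centre of the cube behind P)] -/
theorem sub_mem_box_of_mem_cubeX [NeZero d] {j M : ℕ} (hwide : ∀ k, L.Lo j k + 2 * M + 2 ≤ L.Hi j k) {x : Site d}
    (hx : x ∈ outerBoundary (zdGraph d) (L.X j)) {z : Site d} (hz : z ∈ L.cubeX j M x) :
    z - x ∈ box d (2 * M + 4) := by
  obtain ⟨h, hxy⟩ := LData.winData_spec hwide hx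
  set i := (L.winData j M x).1
  set σ := (L.winData j M x).2.1
  set y := (L.winData j M x).2.2
  have hzc : z - vctr (L.Lo j) (L.Hi j) M i σ y ∈ box d M := mem_cube_iff_sub_mem_box.1 hz
  rw [mem_box] at hzc ⊢
  intro k
  have h1 := hzc k
  have h2 := abs_wctr_sub_le h k
  have h3 : vctr (L.Lo j) (L.Hi j) M i σ y k =
      wctr (L.Lo j) (L.Hi j) M i y k - if k = i then σ * ((M : ℤ) + 1) else 0 := vctr_apply k
  have h4 : x k = y k + if k = i then σ else 0 := by rw [hxy]; exact add_smul_unitVec_apply y σ i k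
  rw [abs_le] at h2
  simp only [Pi.sub_apply] at h1 ⊢
  push_cast at h1 h2 ⊢
  by_cases hk : k = i
  · rw [if_pos hk] at h3 h4
    have hw : wctr (L.Lo j) (L.Hi j) M i y k = y k := by rw [hk]; exact wctr_apply_self
    rcases h.sign with hs | hs
    · have hσ : σ * ((M : ℤ) + 1) = (M : ℤ) + 1 := by rw [hs, one_mul]
      rw [hs] at h4
      constructor <;> linarith [h1.1, h1.2]
    · have hσ : σ * ((M : ℤ) + 1) = -((M : ℤ) + 1) := by rw [hs]; ring
      rw [hs] at h4
      constructor <;> linarith [h1.1, h1.2]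
  · rw [if_neg hk] at h3 h4
    constructor <;> linarith [h1.1, h1.2, h2.1, h2.2]

/-- The cube behind a contact vertex lies inside `B⟨j⟩`. [cite: KozmaNitzan2024, §4 p. 19 ("v + [-M,M]^d ⊆ S")] -/
theorem cubeX_subset_X [NeZero d] {j M : ℕ} (hwide : ∀ k, L.Lo j k + 2 * M + 2 ≤ L.Hi j k) {x : Site d}
    (hx : x ∈ outerBoundary (zdGraph d) (L.X j)) : L.cubeX j M x ⊆ L.X j := by
  obtain ⟨h, -⟩ := LData.winData_spec hwide hx
  rw [LData.X_eq]
  refine (cube_subset_shrink h).trans (Finset.Icc_subset_Icc (fun k => ?_) (fun k => ?_))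
  · simp only [Pi.add_apply, Pi.one_apply]; omega
  · simp only [Pi.sub_apply, Pi.one_apply]; omega

/-- The cube has at most `(2M+1)^d` vertices, hence at most `2d(2M+1)^d` lattice edges inside it. [folklore] -/
theorem card_edgesIn_cubeX_le [NeZero d] (j M : ℕ) (x : Site d) :
    (edgesIn (zdGraph d) (L.cubeX j M x)).card ≤ 2 * d * (2 * M + 1) ^ d := by
  refine (card_edgesIn_le _).trans (Nat.mul_le_mul_left _ ?_)
  unfold LData.cubeX cube
  refine card_Icc_le_pow fun k => ?_
  simp only [Pi.add_apply, Pi.sub_apply, Pi.natCast_apply]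
  omega

/-- Both endpoints of every pair of a cube seed are within sup-distance `2M + 4` of the contact vertex. [folklore] -/
theorem sub_mem_box_of_mem_cubeSeed [NeZero d] {j M : ℕ} (hwide : ∀ k, L.Lo j k + 2 * M + 2 ≤ L.Hi j k) {x : Site d}
    (hx : x ∈ outerBoundary (zdGraph d) (L.X j)) {e : Sym2 (Site d)}
    (he : e ∈ L.seedE j M x ∪ edgesIn (zdGraph d) (L.cubeX j M x)) {z : Site d} (hz : z ∈ e) :
    z - x ∈ box d (2 * M + 4) := by
  rcases Finset.mem_union.1 he with he | he
  · obtain ⟨h, hxy⟩ := LData.winData_spec hwide hx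
    have := sub_mem_box_of_mem_seedEdges h he hz
    rwa [← hxy] at this
  · exact sub_mem_box_of_mem_cubeX hwide hx ((mem_edgesIn_iff.1 he).2 z hz)

/-- **Far-apart contacts have disjoint cube seeds.** [cite: KozmaNitzan2024, §4 p. 19] -/
theorem cubeSeed_disjoint [NeZero d] {j M : ℕ} (hwide : ∀ k, L.Lo j k + 2 * M + 2 ≤ L.Hi j k) {x x' : Site d}
    (hx : x ∈ outerBoundary (zdGraph d) (L.X j)) (hx' : x' ∈ outerBoundary (zdGraph d) (L.X j))
    (hfar : x' - x ∉ box d (2 * LData.Rsep M)) :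
    Disjoint (L.seedE j M x ∪ edgesIn (zdGraph d) (L.cubeX j M x)) (L.seedE j M x' ∪ edgesIn (zdGraph d) (L.cubeX j M x')) := by
  rw [Finset.disjoint_left]
  intro e he he'
  induction e using Sym2.ind with
  | h a b =>
    have ha := sub_mem_box_of_mem_cubeSeed hwide hx he (Sym2.mem_mk_left a b)
    have ha' := sub_mem_box_of_mem_cubeSeed hwide hx' he' (Sym2.mem_mk_left a b)
    apply hfar
    rw [mem_box] at ha ha' ⊢
    intro k
    have h1 := ha k; have h2 := ha' k
    simp only [Pi.sub_apply, LData.Rsep] at h1 h2 ⊢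
    push_cast at h1 h2 ⊢
    omega

/-- Cube-seed pairs are not pairs of the region outside `B⟨j⟩` (each has an endpoint in `B⟨j⟩`). [folklore] -/
theorem cubeSeed_not_mem_wireSet_region [NeZero d] {j M : ℕ} (hwide : ∀ k, L.Lo j k + 2 * M + 2 ≤ L.Hi j k) {x : Site d}
    (hx : x ∈ outerBoundary (zdGraph d) (L.X j)) {e : Sym2 (Site d)}
    (he : e ∈ L.seedE j M x ∪ edgesIn (zdGraph d) (L.cubeX j M x)) : e ∉ wireSet (L.region j) := by
  intro hmem
  rcases Finset.mem_union.1 he with he | he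
  · obtain ⟨-, ⟨z, hz, hzX⟩, -⟩ := LData.mem_seedE hwide hx he
    exact ((mk_mem_wireSet_iff.1 (show s(z, Sym2.Mem.other hz) ∈ wireSet (L.region j) by
      rwa [Sym2.other_spec hz])).1).1 (Finset.mem_coe.2 hzX)
  · induction e using Sym2.ind with
    | h a b =>
      have haX : a ∈ L.X j := cubeX_subset_X hwide hx ((mem_edgesIn_iff.1 he).2 a (Sym2.mem_mk_left a b))
      exact ((mk_mem_wireSet_iff.1 hmem).1).1 (Finset.mem_coe.2 haX)

end CubeGeometry

/-! ## The cube seeds: weights, Step III, and the attachment -/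

section CubeSeeds

variable {L : LData d} {D : Finset (Site d)} {R : ℕ} (hL : LHyp L W p D R)
include hL

/-- Cube-seed pairs carry weight `p` (they are lattice edges inside `D`). [cite: KozmaNitzan2024, §4 p. 19] -/
theorem W_cubeSeed [NeZero d] {j M : ℕ} (hj : j ≤ R) (hwide : ∀ k, L.Lo j k + 2 * M + 2 ≤ L.Hi j k) {x : Site d}
    (hx : x ∈ outerBoundary (zdGraph d) (L.X j)) {e : Sym2 (Site d)}
    (he : e ∈ L.seedE j M x ∪ edgesIn (zdGraph d) (L.cubeX j M x)) : W e = p := by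
  rcases Finset.mem_union.1 he with he | he
  · exact hL.W_seedE hj hwide hx he
  · induction e using Sym2.ind with
    | h a b =>
      obtain ⟨hadj, hmem⟩ := mem_edgesIn_iff.1 he
      rw [SimpleGraph.mem_edgeSet] at hadj
      have ha : a ∈ D := hL.X_subset_D (by omega) (cubeX_subset_X hwide hx (hmem a (Sym2.mem_mk_left a b)))
      have hb : b ∈ D := hL.X_subset_D (by omega) (cubeX_subset_X hwide hx (hmem b (Sym2.mem_mk_right a b)))
      rw [hL.sub.inside a ha b hb hadj.ne, if_pos hadj]

/-- **STEP III, eq. (19), for the CUBE seeds**: with at least `Ncont d M k` contact vertices at level `j ≤ R` (levels wide enough for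
the windows), the probability that no selected contact vertex carries a fully open cube seed
`L.seedE j M x ∪ edgesIn (zdGraph d) (L.cubeX j M x)` is at most `(1 - π^(seedBound d M + 2d(2M+1)^d))^k`.
[cite: KozmaNitzan2024, §4 p. 19 eq. (19)] [cite: Grimmett2006, Thm. (4.17)(b) (p. 75)] -/
theorem real_manyContacts_diff_cubeSeeds_le [NeZero d] {π : ℝ} (hπ0 : 0 ≤ π) (hπ1 : π ≤ 1)
    (hins : ∀ (F : Finset (Sym2 (Site d))) (A : Set (BondConfig (Site d))), (∀ e ∈ F, W e = p) → MeasurableSet A →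
      π ^ F.card * μ.real ((fun ω => ω ∪ ↑F) ⁻¹' A) ≤ μ.real A)
    {j M k : ℕ} (hj : j ≤ R) (hwide : ∀ k, L.Lo j k + 2 * M + 2 ≤ L.Hi j k) :
    μ.real ((L.Fail (LData.Ncont d M k) j)ᶜ \
        ⋃ x ∈ outerBoundary (zdGraph d) (L.X j), ({ω | x ∈ L.sel j M k ω} ∩
          {ω | (↑(L.seedE j M x ∪ edgesIn (zdGraph d) (L.cubeX j M x)) : Set (Sym2 (Site d))) ⊆ ω})) ≤
      (1 - π ^ (seedBound d M + 2 * d * (2 * M + 1) ^ d)) ^ k :=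
  real_manyContacts_diff_biUnion_le μ hπ0 hπ1 hins (fun x => L.seedE j M x ∪ edgesIn (zdGraph d) (L.cubeX j M x))
    (fun _ hx _ he => W_cubeSeed hL hj hwide hx he)
    (fun x _ => (Finset.card_union_le _ _).trans (Nat.add_le_add card_seedEdges_le (card_edgesIn_cubeX_le j M x)))
    (fun _ hx _ he => cubeSeed_not_mem_wireSet_region hwide hx he)
    (fun _ hx _ hx' _ hfar => cubeSeed_disjoint hwide hx hx' hfar)

omit hL in
/-- **An open cube seed joins its contact vertex to every vertex of the cube** (through the window, the inward layer to the face
`U(P) ⊆ Q`, and open lattice edges inside the cube). [cite: KozmaNitzan2024, §4 p. 21 ("P connects to w")] -/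
theorem openConn_of_cubeSeed_subset [NeZero d] {j M : ℕ} (hwide : ∀ k, L.Lo j k + 2 * M + 2 ≤ L.Hi j k) {x : Site d}
    (hx : x ∈ outerBoundary (zdGraph d) (L.X j)) {ω : BondConfig (Site d)}
    (hω : (↑(L.seedE j M x ∪ edgesIn (zdGraph d) (L.cubeX j M x)) : Set (Sym2 (Site d))) ⊆ ω)
    {z : Site d} (hz : z ∈ L.cubeX j M x) : ω ∈ openConn x z := by
  obtain ⟨h, hxy⟩ := LData.winData_spec hwide hx
  set i := (L.winData j M x).1
  set σ := (L.winData j M x).2.1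
  set y := (L.winData j M x).2.2
  have hseed : (↑(L.seedE j M x) : Set (Sym2 (Site d))) ⊆ ω := fun e he =>
    hω (Finset.mem_coe.2 (Finset.mem_union_left _ (Finset.mem_coe.1 he)))
  have hcube : (↑(edgesIn (zdGraph d) (L.cubeX j M x)) : Set (Sym2 (Site d))) ⊆ ω := fun e he =>
    hω (Finset.mem_coe.2 (Finset.mem_union_right _ (Finset.mem_coe.1 he)))
  -- a vertex of the face `U(P)`: the inward translate of the window centre
  set u : Site d := wctr (L.Lo j) (L.Hi j) M i y - σ • unitVec i with hu
  have huU : u ∈ uface (L.Lo j) (L.Hi j) M i σ y := by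
    rw [mem_uface_iff, hu, sub_add_cancel]; exact wctr_mem_plaq
  have h1 : ω ∈ openConn x u := by
    have := openConn_of_seedEdges_subset h hseed huU
    rwa [← hxy] at this
  have huQ : u ∈ L.cubeX j M x := uface_subset_cube h huU
  -- inside the cube
  have h2 : (openGraph ω).Reachable u z := by
    have hp : PathIn (zdGraph d) (↑(L.cubeX j M x) : Set (Site d)) u z := by
      unfold LData.cubeX cube at huQ hz ⊢
      exact exists_pathIn_Icc huQ hz
    exact reachable_of_pathIn (pathIn_openGraph_of_edgesIn_subset hcube hp)
  exact SimpleGraph.Reachable.trans h1 h2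

end CubeSeeds

end Summit.CriticalPhenomena.PercolationContinuityZ3.Theorems.FK.KNFree

end
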